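import Summits.QuantumFields.BalabanUV.Beta.EriceRemainderEnclosureHistoryAutonomyComparisonAgeCompositionThreeAgesDefectAbsReduction
import Summits.QuantumFields.BalabanUV.Beta.EriceRemainderEnclosureHistoryAutonomyComparisonAgeCompositionDecayBoundaryFlowFacts

/-!
# EriceRemainderEnclosureHistoryAutonomyComparisonAgeCompositionThreeAgesDefectMonotone — (E87q) route (N), first order, THREE loaded ages: the DEPTH
# MONOTONICITIES behind the product-form reduction of (★h°) (README g78/e87 §4, «v5») — along every flow the total load `F_t` is non-increasing in the scale,
# the floor products over windows of fixed length are non-decreasing in the depth, the chain-ratio majorant `ρUp` of (E87i) is non-increasing, the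
# levels-and-loads minorant `τlo` of (E87o) is non-decreasing, and hence the complete young floor row `ALa(p)∕q_p = Σ_l Pf(p+1+l,p+k₂)·τlo(p+1+l)` is
# NON-DECREASING in the pin `p` — the fact that lets the defect credit `(1−r)·Σ_{l'} Pf_{l'}·ALa(m+1+l')` be compared with its first term

Cell `pub-balaban`, β-function sub-cell, BINDER row D4 «RemainderConst leaves for Bałaban's split» (`HOME/BINDER-OWNERS.md`; owner lineage `b2b-balaban-beta-an4`;
this file by co-owner #2 lineage `b2b-balaban-beta-d4-p2`, generation 78), β-FLOW TEAM duty (1), FREEZE (0) honoured (def-free; imports (E87o), (E85e₁); uses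
(E85e₁) `windowRatio_mono`, (E82b) `load_le_of_window` BY NAME; nothing restated).

HONEST FRAMING (page 1, verbatim and binding).  *"Discharging BetaPertH makes Bałaban's UV stability UNCONDITIONAL — a real constructive-QFT result; it is
NOT the continuum limit and NOT the Clay problem."*  THIS FILE DISCHARGES NOTHING OF THE KIND.  Elementary real analysis about ABSTRACT functionals on a box
]0,γ]^ℕ with displayed floors, profiles and signs — hypotheses of a census, not facts; the form, signs, ages and moments of Bałaban's (1.22) limit functional
are NOT PRINTED ([I] p. 298; GAPS G-t4-U2-1∕-2) and NOT asserted.  Row D4 class UNCHANGED (critical-path width 0; instance 0∕1; D4 DISCHARGE NO DATE).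
HONEST DEPENDENCY: continuum YM on T⁴ ⇐ BetaPertH ∧ nine spine estimates (0/9 proved); BetaPertH ⇐ (D1) ∧ (D4) ∧ CAP+tail; G-an2-4 gates asym, D1 and NE2/3/4.

THE POINT (census sense (α); route (N); README `HOME/b2b-balaban-beta-d4-p2/g78/e87/README.md` §4 (1)).  The damping-free inequality (★h°) ((E87o)∕(E87p)) is
SUM-structured; the reduction «v5» measured there (bench, k₃ ≤ 256: exact `−0.29 … −0.60`, v5 `−0.17 … −0.55`, its linearised budget `≥ +0.10` at the
hardest pin) rests on ONE monotonicity: the complete young floor row per unit coefficient, `Σ_{l<k₂} Pf(p+1+l,p+k₂)·τlo(p+1+l)`, does not decrease with the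
depth `p`.  §1 **`loadsum_antitone`** (`F_{t+1} ≤ F_t`), **`floorProd_antitone`** (`Π_{i<n}(1+F_{s+1+i}) ≤ Π_{i<n}(1+F_{s+i})`); §2 **`rhoUp_antitone`**
(`ρUp_{p+1} ≤ ρUp_p` for `p ≥ 1`: the coefficients fall, the `k₂`-lag level ratio across the old age's depth rises ((E85e₁) `windowRatio_mono`), its floor
product falls); §3 **`taulo_mono`** (`τlo(p) ≤ τlo(p+1)`, `p ≥ 1`); §4 **`youngFloorRow_mono`**: `Σ_{l<k₂} Pf(p+1+l,p+k₂)·τlo(p+1+l) ≤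
Σ_{l<k₂} Pf(p+2+l,p+1+k₂)·τlo(p+2+l)` for `p ≥ 1` (true on every benchmark row, kit j335932∕j335940).  NOT CLAIMED: v5 itself or (★h°) along flows
(successor); anything nonlinear; anything printed — NOT B12 Thm 2, NOT BetaPertH.

WHAT IS PROVED ([folklore]; 0 `def`, 0 sorry).  §1 **`loadsum_antitone`**, **`floorProd_antitone`**, `prod_Ico_shift`; §2 **`rhoUp_antitone`**; §3 `max_step`,
**`taulo_mono`**; §4 **`youngFloorRow_mono`**.
-/
noncomputable section
open Finset

namespace Summit.QuantumFields.BalabanUV.Beta.EriceRemainderEnclosureHistoryAutonomyComparisonAgeCompositionThreeAgesDefectMonotone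

open Literature.MathematicalPhysics.QuantumFieldTheory.Balaban1983to89
open Literature.MathematicalPhysics.QuantumFieldTheory.Balaban1983to89.T4BetaStationary
open Literature.MathematicalPhysics.QuantumFieldTheory.Balaban1983to89.T4BetaFlowWellPosed
open Summit.QuantumFields.BalabanUV.Beta.EriceRemainderEnclosureHistoryAutonomyOrder (strictAnti_of_memFlow)
open Summit.QuantumFields.BalabanUV.Beta.EriceRemainderEnclosureHistoryAutonomyComparisonAgeCompositionYoungestTailSumFlow (load_le_of_window)
open Summit.QuantumFields.BalabanUV.Beta.EriceRemainderEnclosureHistoryAutonomyComparisonAgeCompositionDecayBoundaryFlowFacts (windowRatio_mono)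

variable {B : (ℕ → ℝ) → ℝ} {γ b gIR : ℝ} {L : ℕ → ℝ} {K : ℕ} {h : ℕ → ℝ}

/-! ## §1 The total load and the floor products along the scale -/

/-- The total load `F_t = Σ_{j<K} L_j h_{t+j}³∕2` is NON-INCREASING in the scale (`h` non-increasing, `L ≥ 0`). [folklore] -/
theorem loadsum_antitone (hL : ∀ k, 0 ≤ L k) (hh0 : ∀ n, 0 < h n) (hanti : Antitone h)
    {F : ℕ → ℝ} (hF : ∀ t, F t = ∑ j ∈ range K, L j * h (t + j) ^ 3 / 2) (t : ℕ) : F (t + 1) ≤ F t := by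
  rw [hF, hF]
  refine sum_le_sum fun j _ => ?_
  have h1 : h (t + 1 + j) ≤ h (t + j) := hanti (by omega)
  have : h (t + 1 + j) ^ 3 ≤ h (t + j) ^ 3 := pow_le_pow_left₀ (hh0 _).le h1 3
  have := hL j
  nlinarith

/-- Floor products over windows of a fixed length FALL with the depth: `Π_{i<n}(1+F_{s+1+i}) ≤ Π_{i<n}(1+F_{s+i})` (`F ≥ 0` non-increasing). [folklore] -/
theorem floorProd_antitone {F : ℕ → ℝ} (hF0 : ∀ t, 0 ≤ F t) (hFa : ∀ t, F (t + 1) ≤ F t) (s n : ℕ) :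
    ∏ i ∈ range n, (1 + F (s + 1 + i)) ≤ ∏ i ∈ range n, (1 + F (s + i)) :=
  prod_le_prod (fun i _ => by have := hF0 (s + 1 + i); positivity) fun i _ => by
    have := hFa (s + i); rw [show s + 1 + i = s + i + 1 by ring]; linarith

/-- Ico-windows as shifted ranges: `Π_{t∈[a, a+n)} f t = Π_{i<n} f (a+i)`. [folklore] -/
theorem prod_Ico_shift (f : ℕ → ℝ) (a n : ℕ) : ∏ t ∈ Ico a (a + n), f t = ∏ i ∈ range n, f (a + i) := by
  rw [prod_Ico_eq_prod_range, show a + n - a = n by omega]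

/-! ## §2 The chain-ratio majorant falls with the depth -/
set_option maxHeartbeats 400000 in
/-- **`ρUp` IS NON-INCREASING IN THE PIN.**  Three-age flow (`{1,k₂,k₃}`, `2 ≤ k₂ < k₃ < K`, box solution `h` of an isotone memory with floor, dominated by
`L ≥ 0`); `q_n = L_{k₂}h_{n+k₂}³∕2`, `c_n = L_{k₃}h_{n+k₃}³∕2`, `F_t = Σ_j L_jh_{t+j}³∕2`, `ρUp_p = k₂q_p·(1 + ϑ₂(p)·k₃c_p∕(1−k₃c_p))∕(1 − k₂c_p)` with
`ϑ₂(p) = 1 − (h_{p+k₃+k₂}∕h_{p+k₃})³·(Π_{t∈[p+k₃+1,p+k₃+k₂]}(1+F_t))⁻¹`.  Then `ρUp_{p+1} ≤ ρUp_p` for every `p ≥ 1`: the coefficients fall, the `k₂`-lag ratio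
`h_{p+k₃+k₂}∕h_{p+k₃}` rises ((E85e₁) `windowRatio_mono`), the floor product falls, and `k₃c_p ≤ 3∕4` ((E82b)). [folklore] -/
theorem rhoUp_antitone (hmono : ∀ u v : ℕ → ℝ, SeqBox γ u → SeqBox γ v → (∀ j, u j ≤ v j) → B u ≤ B v)
    (hL : ∀ k, 0 ≤ L k) (hb : 0 < b) (hlo : ∀ u, SeqBox γ u → b ≤ B u) (hdom : ∀ u, SeqBox γ u → ∑ k ∈ range K, L k * u k ≤ B u)
    (hh : SeqBox γ h) (hf : MemFlow B gIR h)
    {k₂ k₃ : ℕ} (hk2 : 2 ≤ k₂) (hk23 : k₂ < k₃) (hk3K : k₃ < K)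
    {q c F ρUp : ℕ → ℝ} (hq : ∀ n, q n = L k₂ * h (n + k₂) ^ 3 / 2) (hc : ∀ n, c n = L k₃ * h (n + k₃) ^ 3 / 2)
    (hF : ∀ t, F t = ∑ j ∈ range K, L j * h (t + j) ^ 3 / 2)
    (hρUp : ∀ p, ρUp p = (k₂ * q p) * (1 + (1 - (h (p + k₃ + k₂) / h (p + k₃)) ^ 3 * (∏ t ∈ Ico (p + k₃ + 1) (p + k₃ + k₂ + 1), (1 + F t))⁻¹) *
      ((k₃ * c p) / (1 - k₃ * c p))) / (1 - k₂ * c p))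
    {p : ℕ} (hp : 1 ≤ p) : ρUp (p + 1) ≤ ρUp p := by
  have hpos : ∀ n, 0 < h n := fun n => (hh n).1
  have hanti := (strictAnti_of_memFlow hb hlo hh hf).antitone
  have hk2r : (2:ℝ) ≤ k₂ := by exact_mod_cast hk2
  have hk23r : (k₂:ℝ) ≤ k₃ := by exact_mod_cast hk23.le
  have hF0 : ∀ t, 0 ≤ F t := fun t => by
    rw [hF]; exact sum_nonneg fun j _ => by have := hL j; have := hpos (t + j); positivity
  have hFa := loadsum_antitone hL hpos hanti hF
  -- coefficients fall and are non-negative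
  have hq0 : ∀ n, 0 ≤ q n := fun n => by rw [hq]; have := hL k₂; have := hpos (n + k₂); positivity
  have hc0 : ∀ n, 0 ≤ c n := fun n => by rw [hc]; have := hL k₃; have := hpos (n + k₃); positivity
  have hqa : q (p + 1) ≤ q p := by
    rw [hq, hq]; have := hL k₂
    have : h (p + 1 + k₂) ^ 3 ≤ h (p + k₂) ^ 3 := pow_le_pow_left₀ (hpos _).le (hanti (by omega)) 3
    nlinarith
  have hca : c (p + 1) ≤ c p := by
    rw [hc, hc]; have := hL k₃
    have : h (p + 1 + k₃) ^ 3 ≤ h (p + k₃) ^ 3 := pow_le_pow_left₀ (hpos _).le (hanti (by omega)) 3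
    nlinarith
  -- the old load is at most 3/4 at both pins
  have hx : ∀ n, 1 ≤ n → k₃ * c n ≤ 3 / 4 := fun n hn => by
    have h1 := load_le_of_window hmono hL hb hlo hdom hh hf hn hk3K
    have h2 : 0 ≤ (h (n + k₃) / h n) ^ 2 := sq_nonneg _
    rw [hc]; linarith
  have hxp := hx p hp; have hxp1 := hx (p + 1) (by omega)
  -- the k₂-lag ratio of the old depth rises, its cube too
  set R0 : ℝ := h (p + k₃ + k₂) / h (p + k₃) with hR0
  set R1 : ℝ := h (p + 1 + k₃ + k₂) / h (p + 1 + k₃) with hR1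
  have hR00 : 0 ≤ R0 := div_nonneg (hpos _).le (hpos _).le
  have hR10 : 0 ≤ R1 := div_nonneg (hpos _).le (hpos _).le
  have hRsq : R0 ^ 2 ≤ R1 ^ 2 := by
    have hw := windowRatio_mono hmono hb hlo hh hf (p + k₃) k₂
    rw [show p + k₃ + 1 + k₂ = p + 1 + k₃ + k₂ by ring, show p + k₃ + 1 = p + 1 + k₃ by ring] at hw
    exact hw
  have hRle : R0 ≤ R1 := by nlinarith [sq_nonneg (R0 + R1), sq_nonneg (R0 - R1)]
  have hR3 : R0 ^ 3 ≤ R1 ^ 3 := pow_le_pow_left₀ hR00 hRle 3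
  have hR1le : R1 ≤ 1 := (div_le_one (hpos _)).mpr (hanti (by omega))
  -- the floor products over [p+k₃+1, p+k₃+k₂] fall
  have hP0 : ∀ a, 0 < ∏ t ∈ Ico a (a + k₂), (1 + F t) := fun a => prod_pos fun t _ => by have := hF0 t; linarith
  have hPge1 : ∀ a, 1 ≤ ∏ t ∈ Ico a (a + k₂), (1 + F t) := fun a => by
    have := prod_le_prod (s := Ico a (a + k₂)) (fun t _ => zero_le_one) (fun t _ => show (1:ℝ) ≤ 1 + F t by linarith [hF0 t])
    simpa using this
  have eI0 : Ico (p + k₃ + 1) (p + k₃ + k₂ + 1) = Ico (p + k₃ + 1) (p + k₃ + 1 + k₂) := by rw [show p + k₃ + k₂ + 1 = p + k₃ + 1 + k₂ by ring]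
  have eI1 : Ico (p + 1 + k₃ + 1) (p + 1 + k₃ + k₂ + 1) = Ico (p + k₃ + 1 + 1) (p + k₃ + 1 + 1 + k₂) := by
    rw [show p + 1 + k₃ + 1 = p + k₃ + 1 + 1 by ring, show p + 1 + k₃ + k₂ + 1 = p + k₃ + 1 + 1 + k₂ by ring]
  have hPa : ∏ t ∈ Ico (p + k₃ + 1 + 1) (p + k₃ + 1 + 1 + k₂), (1 + F t) ≤ ∏ t ∈ Ico (p + k₃ + 1) (p + k₃ + 1 + k₂), (1 + F t) := by
    rw [prod_Ico_shift, prod_Ico_shift]; exact floorProd_antitone hF0 hFa _ _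
  -- hence the defect majorant falls: ϑ₂(p+1) ≤ ϑ₂(p), both in [0,1]
  set P0 : ℝ := ∏ t ∈ Ico (p + k₃ + 1) (p + k₃ + 1 + k₂), (1 + F t) with hP0d
  set P1 : ℝ := ∏ t ∈ Ico (p + k₃ + 1 + 1) (p + k₃ + 1 + 1 + k₂), (1 + F t) with hP1d
  have hP0pos : 0 < P0 := hP0 _
  have hP1pos : 0 < P1 := hP0 _
  have hϑle : 1 - R1 ^ 3 * P1⁻¹ ≤ 1 - R0 ^ 3 * P0⁻¹ := by
    have h1 : R0 ^ 3 * P0⁻¹ ≤ R1 ^ 3 * P0⁻¹ := mul_le_mul_of_nonneg_right hR3 (inv_nonneg.mpr hP0pos.le)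
    have h2 : R1 ^ 3 * P0⁻¹ ≤ R1 ^ 3 * P1⁻¹ :=
      mul_le_mul_of_nonneg_left ((inv_le_inv₀ hP0pos hP1pos).mpr hPa) (pow_nonneg hR10 3)
    linarith
  have hϑ0 : 0 ≤ 1 - R1 ^ 3 * P1⁻¹ := by
    have h1 : R1 ^ 3 ≤ 1 := pow_le_one₀ hR10 hR1le
    have h2 : P1⁻¹ ≤ 1 := inv_le_one_of_one_le₀ (hPge1 _)
    have := mul_le_mul h1 h2 (inv_nonneg.mpr hP1pos.le) zero_le_one
    linarith
  -- the old fraction falls: k₃c/(1−k₃c)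
  have hω : (k₃ * c (p + 1)) / (1 - k₃ * c (p + 1)) ≤ (k₃ * c p) / (1 - k₃ * c p) := by
    rw [div_le_div_iff₀ (by linarith) (by linarith)]
    have : (k₃:ℝ) * c (p + 1) ≤ k₃ * c p := by nlinarith
    nlinarith
  have hω0 : 0 ≤ (k₃ * c (p + 1)) / (1 - k₃ * c (p + 1)) := div_nonneg (by have := hc0 (p + 1); positivity) (by linarith)
  -- assemble: numerator falls, denominator rises
  rw [hρUp, hρUp, eI0, eI1]
  have hN1 : 0 ≤ 1 + (1 - R1 ^ 3 * P1⁻¹) * ((k₃ * c (p + 1)) / (1 - k₃ * c (p + 1))) := by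
    have := mul_nonneg hϑ0 hω0; linarith
  have hNle : 1 + (1 - R1 ^ 3 * P1⁻¹) * ((k₃ * c (p + 1)) / (1 - k₃ * c (p + 1))) ≤
      1 + (1 - R0 ^ 3 * P0⁻¹) * ((k₃ * c p) / (1 - k₃ * c p)) := by
    have := mul_le_mul hϑle hω hω0 (hϑ0.trans hϑle); linarith
  have hnum : (k₂ * q (p + 1)) * (1 + (1 - R1 ^ 3 * P1⁻¹) * ((k₃ * c (p + 1)) / (1 - k₃ * c (p + 1)))) ≤
      (k₂ * q p) * (1 + (1 - R0 ^ 3 * P0⁻¹) * ((k₃ * c p) / (1 - k₃ * c p))) :=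
    mul_le_mul (by nlinarith [hq0 (p + 1)]) hNle hN1 (by have := hq0 p; positivity)
  have hk2c : k₂ * c p < 1 := by nlinarith [hc0 p]
  have hk2c1 : k₂ * c (p + 1) ≤ k₂ * c p := by nlinarith
  have hnum0 : 0 ≤ (k₂ * q p) * (1 + (1 - R0 ^ 3 * P0⁻¹) * ((k₃ * c p) / (1 - k₃ * c p))) :=
    le_trans (mul_nonneg (by have := hq0 (p + 1); positivity) hN1) hnum
  calc (k₂ * q (p + 1)) * (1 + (1 - R1 ^ 3 * P1⁻¹) * ((k₃ * c (p + 1)) / (1 - k₃ * c (p + 1)))) / (1 - k₂ * c (p + 1))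
      ≤ (k₂ * q p) * (1 + (1 - R0 ^ 3 * P0⁻¹) * ((k₃ * c p) / (1 - k₃ * c p))) / (1 - k₂ * c (p + 1)) :=
        div_le_div_of_nonneg_right hnum (by linarith)
    _ ≤ (k₂ * q p) * (1 + (1 - R0 ^ 3 * P0⁻¹) * ((k₃ * c p) / (1 - k₃ * c p))) / (1 - k₂ * c p) :=
        div_le_div_of_nonneg_left hnum0 (by linarith) (by linarith)

/-! ## §3 The levels-and-loads minorant `τlo` rises with the depth -/

/-- The abstract step: `max (max (A·B) C) 0 ≤ max (max (A'·B') C') 0` when `A ≤ A'`, `0 ≤ B ≤ B'`, `C ≤ C'` (if `A < 0` the product is `≤ 0`). [folklore] -/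
theorem max_step {A A' B B' C C' : ℝ} (hA : A ≤ A') (hB : B ≤ B') (hB0 : 0 ≤ B) (hC : C ≤ C') :
    max (max (A * B) C) 0 ≤ max (max (A' * B') C') 0 := by
  refine max_le (max_le ?_ (le_max_of_le_left (le_max_of_le_right hC))) (le_max_right _ _)
  rcases le_or_gt 0 A with hA0 | hA0
  · exact le_max_of_le_left (le_max_of_le_left (mul_le_mul hA hB hB0 (hA0.trans hA)))
  · exact (mul_nonpos_of_nonpos_of_nonneg hA0.le hB0).trans (le_max_right _ _)

/-- **`τlo` IS NON-DECREASING IN THE PIN** (`p ≥ 1`): `τlo(p) = max((1−ρUp_p)(1−k₃c_p), 1 − k₃c_p − k₂q_p, 0)` with `ρUp` falling (§2), the coefficients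
falling, and `k₃c_p ≤ 3∕4`. [folklore] -/
theorem taulo_mono (hmono : ∀ u v : ℕ → ℝ, SeqBox γ u → SeqBox γ v → (∀ j, u j ≤ v j) → B u ≤ B v)
    (hL : ∀ k, 0 ≤ L k) (hb : 0 < b) (hlo : ∀ u, SeqBox γ u → b ≤ B u) (hdom : ∀ u, SeqBox γ u → ∑ k ∈ range K, L k * u k ≤ B u)
    (hh : SeqBox γ h) (hf : MemFlow B gIR h)
    {k₂ k₃ : ℕ} (hk2 : 2 ≤ k₂) (hk23 : k₂ < k₃) (hk3K : k₃ < K)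
    {q c F ρUp τlo : ℕ → ℝ} (hq : ∀ n, q n = L k₂ * h (n + k₂) ^ 3 / 2) (hc : ∀ n, c n = L k₃ * h (n + k₃) ^ 3 / 2)
    (hF : ∀ t, F t = ∑ j ∈ range K, L j * h (t + j) ^ 3 / 2)
    (hρUp : ∀ p, ρUp p = (k₂ * q p) * (1 + (1 - (h (p + k₃ + k₂) / h (p + k₃)) ^ 3 * (∏ t ∈ Ico (p + k₃ + 1) (p + k₃ + k₂ + 1), (1 + F t))⁻¹) *
      ((k₃ * c p) / (1 - k₃ * c p))) / (1 - k₂ * c p))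
    (hτlo : ∀ p', τlo p' = max (max ((1 - ρUp p') * (1 - k₃ * c p')) (1 - k₃ * c p' - k₂ * q p')) 0)
    {p : ℕ} (hp : 1 ≤ p) : τlo p ≤ τlo (p + 1) := by
  have hpos : ∀ n, 0 < h n := fun n => (hh n).1
  have hanti := (strictAnti_of_memFlow hb hlo hh hf).antitone
  have hqa : q (p + 1) ≤ q p := by
    rw [hq, hq]; have := hL k₂
    have : h (p + 1 + k₂) ^ 3 ≤ h (p + k₂) ^ 3 := pow_le_pow_left₀ (hpos _).le (hanti (by omega)) 3
    nlinarith
  have hca : c (p + 1) ≤ c p := by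
    rw [hc, hc]; have := hL k₃
    have : h (p + 1 + k₃) ^ 3 ≤ h (p + k₃) ^ 3 := pow_le_pow_left₀ (hpos _).le (hanti (by omega)) 3
    nlinarith
  have hx : k₃ * c p ≤ 3 / 4 := by
    have h1 := load_le_of_window hmono hL hb hlo hdom hh hf hp hk3K
    have h2 : 0 ≤ (h (p + k₃) / h p) ^ 2 := sq_nonneg _
    rw [hc]; linarith
  have hρ := rhoUp_antitone hmono hL hb hlo hdom hh hf hk2 hk23 hk3K hq hc hF hρUp hp
  have hk2r : (0:ℝ) ≤ k₂ := by positivity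
  have hk3r : (0:ℝ) ≤ k₃ := by positivity
  rw [hτlo, hτlo]
  exact max_step (by linarith) (by nlinarith) (by linarith) (by nlinarith)

/-! ## §4 The complete young floor row per unit coefficient rises with the depth -/

/-- **THE YOUNG FLOOR ROW IS NON-DECREASING IN THE PIN.**  With `Pf(a,b) = Π_{t∈[a,b]}(1+F_t)⁻¹` and `τlo` as in §3, for every `p ≥ 1`:
`Σ_{l<k₂} Pf(p+1+l, p+k₂)·τlo(p+1+l) ≤ Σ_{l<k₂} Pf(p+2+l, p+1+k₂)·τlo(p+2+l)` — lag by lag the floor window of length `k₂−l` moves one scale deeper (its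
product falls, §1) and `τlo` rises (§3).  This is the monotonicity «`ALa(p)∕q_p ↑`» of README g78/e87 §4 (v5). [folklore] -/
theorem youngFloorRow_mono (hmono : ∀ u v : ℕ → ℝ, SeqBox γ u → SeqBox γ v → (∀ j, u j ≤ v j) → B u ≤ B v)
    (hL : ∀ k, 0 ≤ L k) (hb : 0 < b) (hlo : ∀ u, SeqBox γ u → b ≤ B u) (hdom : ∀ u, SeqBox γ u → ∑ k ∈ range K, L k * u k ≤ B u)
    (hh : SeqBox γ h) (hf : MemFlow B gIR h)
    {k₂ k₃ : ℕ} (hk2 : 2 ≤ k₂) (hk23 : k₂ < k₃) (hk3K : k₃ < K)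
    {q c F ρUp τlo : ℕ → ℝ} {Pf : ℕ → ℕ → ℝ} (hq : ∀ n, q n = L k₂ * h (n + k₂) ^ 3 / 2) (hc : ∀ n, c n = L k₃ * h (n + k₃) ^ 3 / 2)
    (hF : ∀ t, F t = ∑ j ∈ range K, L j * h (t + j) ^ 3 / 2) (hPf : ∀ a b, Pf a b = (∏ t ∈ Ico a (b + 1), (1 + F t))⁻¹)
    (hρUp : ∀ p, ρUp p = (k₂ * q p) * (1 + (1 - (h (p + k₃ + k₂) / h (p + k₃)) ^ 3 * (∏ t ∈ Ico (p + k₃ + 1) (p + k₃ + k₂ + 1), (1 + F t))⁻¹) *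
      ((k₃ * c p) / (1 - k₃ * c p))) / (1 - k₂ * c p))
    (hτlo : ∀ p', τlo p' = max (max ((1 - ρUp p') * (1 - k₃ * c p')) (1 - k₃ * c p' - k₂ * q p')) 0)
    {p : ℕ} (hp : 1 ≤ p) :
    ∑ l ∈ range k₂, Pf (p + 1 + l) (p + k₂) * τlo (p + 1 + l) ≤ ∑ l ∈ range k₂, Pf (p + 2 + l) (p + 1 + k₂) * τlo (p + 2 + l) := by
  have hpos : ∀ n, 0 < h n := fun n => (hh n).1
  have hanti := (strictAnti_of_memFlow hb hlo hh hf).antitone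
  have hF0 : ∀ t, 0 ≤ F t := fun t => by
    rw [hF]; exact sum_nonneg fun j _ => by have := hL j; have := hpos (t + j); positivity
  have hFa := loadsum_antitone hL hpos hanti hF
  have hτ0 : ∀ p', 0 ≤ τlo p' := fun p' => by rw [hτlo]; exact le_max_right _ _
  refine sum_le_sum fun l hl => ?_
  have hlk : l < k₂ := mem_range.mp hl
  -- the floor window of length k₂ − l, one scale deeper
  have hP : Pf (p + 1 + l) (p + k₂) ≤ Pf (p + 2 + l) (p + 1 + k₂) := by
    rw [hPf, hPf, show p + k₂ + 1 = p + 1 + l + (k₂ - l) by omega, show p + 1 + k₂ + 1 = p + 2 + l + (k₂ - l) by omega,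
      prod_Ico_shift, prod_Ico_shift]
    have hpos0 : 0 < ∏ i ∈ range (k₂ - l), (1 + F (p + 2 + l + i)) := prod_pos fun i _ => by have := hF0 (p + 2 + l + i); linarith
    refine (inv_le_inv₀ (prod_pos fun i _ => by have := hF0 (p + 1 + l + i); linarith) hpos0).mpr ?_
    have := floorProd_antitone hF0 hFa (p + 1 + l) (k₂ - l)
    rw [show p + 1 + l + 1 = p + 2 + l by ring] at this
    exact this
  have hP0 : 0 ≤ Pf (p + 2 + l) (p + 1 + k₂) := by
    rw [hPf]; exact inv_nonneg.mpr (prod_nonneg fun t _ => by have := hF0 t; linarith)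
  have hτ : τlo (p + 1 + l) ≤ τlo (p + 2 + l) := by
    have := taulo_mono hmono hL hb hlo hdom hh hf hk2 hk23 hk3K hq hc hF hρUp hτlo (p := p + 1 + l) (by omega)
    rwa [show p + 1 + l + 1 = p + 2 + l by ring] at this
  exact mul_le_mul hP hτ (hτ0 _) hP0

end Summit.QuantumFields.BalabanUV.Beta.EriceRemainderEnclosureHistoryAutonomyComparisonAgeCompositionThreeAgesDefectMonotone

end
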